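import Literature.AlgebraicGeometry.HodgeTheory.FermatAokiCycleInvariance
import Literature.AlgebraicGeometry.HodgeTheory.FermatRationalSupport
import HarnessLib

/-!
# The eigencomponents `ω_α([Y])` of Aoki's cycle vanish unless `α` is trivial on `G₀ ∩ Ker(1, …, 1, -p)` (Aoki §4 (4.1))

Family `hodge`, layer `Literature/AlgebraicGeometry/HodgeTheory`. PROOF FILE (theorems only, no named
fact; sequel of `FermatAokiCycleInvariance`) for the leaf `Aoki1987_thm_2_1_supportedClass` of
`Aoki1987_claim_pStandard` — N. Aoki, J. Math. Soc. Japan 39 (1987), Prop. 3-1 (ii) (p. 389: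
`G_Y = G₀ ∩ Ker σ`, "in particular `G_Y ⊂ Ker σ`") and §4 (4.1): since `h^*[Y] = [Y]` for `h ∈ G_Y`,
the class `[Y]` lies in `⊕_{α|G_Y = 1} V(α)`, i.e. `ω_α(Y) = 0` unless `α` is trivial on `G_Y` — the
reason why `σ_{p,a}` (trivial on `G₀ ∩ Ker(1, …, 1, -p)`) is the character `Y` can represent, and the
first step of the orbit-sum computation of `ω_σ(Y)·\overline{ω_σ(Y)}`.

* `fermatProjector_map_diagonalMap` — **`π_α(g_a^* c) = χ_α(a) • π_α(c)`** for `a ∈ μₘⁿ⁺²`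
  (`g_a^*` is `χ_β(a)` on `V(β)`, and `c = Σ_β π_β c`);
* **`Aoki1987.fermatProjector_cycleClass_fermatAokiCycle_eq_zero_of_ne_one`** — for `a ∈ μₘ²ʳ⁺²`
  with `a₀ᵈ = ⋯ = a_{p-1}ᵈ` and `a_pᵖ = a₀⋯a_{p-1}` (`g_a ∈ G₀ ∩ Ker(1, …, 1, -p) ⊆ G_Y`) and a
  character `α` with `χ_α(a) ≠ 1`: `ω_α([Y]) = π_α(cl[Y]) = 0` (`g_a^* cl[Y] = cl[Y]`,
  `Aoki1987.map_diagonalAut_cycleClass_fermatAokiCycle_eq`).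

## References

* [Aoki1987] N. Aoki, Some new algebraic cycles on Fermat varieties, J. Math. Soc. Japan 39 (1987)
  385–396: Prop. 3-1 (ii) (p. 389), §4 (4.1).
* [Shioda1979PJA] T. Shioda, Proc. Japan Acad. 55A (1979) 111–114, §4 (the eigenspaces `V(α)`).
-/

noncomputable section

open CategoryTheory AlgebraicGeometry MvPolynomial Finset Order

namespace Literature.AlgebraicGeometry.HodgeTheory

open Literature.AlgebraicGeometry.Motives Literature.AlgebraicTopology.SingularHomology

section Projector

variable {n m : ℕ}

/-- **`π_α(g_a^* c) = χ_α(a) • π_α(c)`** for a diagonal symmetry `a ∈ μₘⁿ⁺²` of `Xⁿₘ`: `g_a^*` acts by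
`χ_β(a)` on `V(β)` and `c = Σ_β π_β c`. [cite: Shioda1979PJA, §4] -/
theorem fermatProjector_map_diagonalMap [NeZero m] (α : Fin (n + 2) → ZMod m) (a : fermatGroup n m)
    {k : ℕ} (c : complexBetti (fermatHypersurface n m) k) :
    fermatProjector m α k (singularCohomology.map ℂ ℂ
        (diagonalMap (fermatPolynomial ℂ n m) (fermatGroup_le_diagonalStabilizer m a.2)) k c) =
      ((fermatCharacter m α a : ℂˣ) : ℂ) • fermatProjector m α k c := by
  classical
  conv_lhs => rw [← sum_fermatProjector c]
  rw [map_sum, map_sum]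
  have hterm : ∀ β : Fin (n + 2) → ZMod m,
      fermatProjector m α k (singularCohomology.map ℂ ℂ
          (diagonalMap (fermatPolynomial ℂ n m) (fermatGroup_le_diagonalStabilizer m a.2)) k
            (fermatProjector m β k c)) =
        if β = α then ((fermatCharacter m α a : ℂˣ) : ℂ) • fermatProjector m α k c else 0 := by
    intro β
    rw [mem_fermatEigenspace_iff.mp (fermatProjector_mem β c) a, map_smul]
    split_ifs with h
    · subst h
      rw [fermatProjector_apply_of_mem (fermatProjector_mem _ c)]
    · rw [fermatProjector_apply_of_mem_of_ne (fermatProjector_mem β c) h, smul_zero]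
  simp_rw [hterm]
  rw [Finset.sum_ite_eq' Finset.univ α, if_pos (Finset.mem_univ α)]

/-- A class fixed by `g_a^*` has `π_α`-component `0` whenever `χ_α(a) ≠ 1`. [cite: Shioda1979PJA, §4] -/
theorem fermatProjector_eq_zero_of_map_diagonalMap_eq [NeZero m] (α : Fin (n + 2) → ZMod m)
    (a : fermatGroup n m) {k : ℕ} {c : complexBetti (fermatHypersurface n m) k}
    (hc : singularCohomology.map ℂ ℂ
        (diagonalMap (fermatPolynomial ℂ n m) (fermatGroup_le_diagonalStabilizer m a.2)) k c = c)
    (hα : fermatCharacter m α a ≠ 1) : fermatProjector m α k c = 0 := by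
  have key := fermatProjector_map_diagonalMap α a c
  rw [hc] at key
  have h1 : (((fermatCharacter m α a : ℂˣ) : ℂ) - 1) • fermatProjector m α k c = 0 := by
    rw [sub_smul, one_smul, ← key, sub_self]
  rcases smul_eq_zero.mp h1 with h | h
  · exact absurd (Units.val_eq_one.mp (sub_eq_zero.mp h)) hα
  · exact h

end Projector

namespace Aoki1987

variable {m r d : ℕ}

/-- **`ω_α([Y]) = 0` unless `α` is trivial on `G₀ ∩ Ker(1, …, 1, -p)`** (Aoki §4 (4.1) with
Prop. 3-1 (ii)): for `a ∈ μₘ²ʳ⁺²` with `a₀ᵈ = ⋯ = a_{p-1}ᵈ` and `a_pᵖ = a₀⋯a_{p-1}` — so that `g_a`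
preserves `Y` and fixes `cl[Y]` (`map_diagonalAut_cycleClass_fermatAokiCycle_eq`) — and a character `α`
of `X²ʳₘ` with `χ_α(a) ≠ 1`, the `α`-component of the cycle class of `[Y]` vanishes.
[cite: Aoki1987, Prop. 3-1 (ii) (p. 389) and §4 (4.1)] -/
theorem fermatProjector_cycleClass_fermatAokiCycle_eq_zero_of_ne_one [NeZero m] (hr : 0 < r) (hm : 1 ≤ m)
    (hd : 0 < d) (c : ℂ) (hX : IsSmoothProjective (2 * r) (fermatHypersurface (2 * r) m))
    (hrr : r + r = 2 * r) (ρ : ResolutionFamily (fermatHypersurface (2 * r) m) r)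
    (a : fermatGroup (2 * r) m) {β : ℂ}
    (hβ : ∀ i : Fin (2 * r + 1), (((a : Fin (2 * r + 2) → ℂˣ) (Fin.castSucc i)) : ℂ) ^ d = β)
    (hρ : (a : Fin (2 * r + 2) → ℂˣ) (Fin.last (2 * r + 1)) ^ (2 * r + 1) =
      ∏ i : Fin (2 * r + 1), (a : Fin (2 * r + 2) → ℂˣ) (Fin.castSucc i))
    {α : Fin (2 * r + 2) → ZMod m} (hα : fermatCharacter m α a ≠ 1) :
    fermatProjector m α (2 * r) (cycleClass complexOrientationFamily hX hrr ρ (fermatAokiCycle hr hm hd c)) = 0 :=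
  fermatProjector_eq_zero_of_map_diagonalMap_eq α a
    (map_diagonalAut_cycleClass_fermatAokiCycle_eq hr hm hd c hX hrr ρ
      (fermatGroup_le_diagonalStabilizer m a.2) hβ hρ) hα

end Aoki1987

end Literature.AlgebraicGeometry.HodgeTheory

end
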